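import Summits.KontsevichZagierPeriods.Zeta5Search.Barrier.ConeGammaFarSliceConc

/-!
# ζ(5) search — BARRIER: `C₀` TO FIRST ORDER IN THE FAR CHART — soundness IIIb: the slice on a whole `X`-interval, the
# `Y`-range and the far point's `X`-range on a z-piece

HONEST FRAMING (cell `pub-zeta5`): systematic search; no irrationality claim unless kernel-certified. Theorems only. MODEL
objects under Brown–Zudilin's (28)+(30) ((28) observed, not proved): cert-2 g39's value function `Envelope.valueV` and its
`X`-log-form `gxF`, the checker's `cellSum` / `concCell` / `concPiece` / `yRange` / `xRange` (`ConeGammaFarSliceCheck`), cert-2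
g38's `xhatAF` (`ConeGammaCritFarValue.xhatAF_mem`). Nothing here is a statement about the size of any critical value of record,
any γ, the cone's supremum (C2 OPEN), S-E (CONJECTURED), (TD_A) or `ζ(5)`; no number of record moves; records in print UNMOVED.
Theory seat cert-2 g40 (item «C₀ TO FIRST ORDER IN THE FAR CHART — THE CENTRE-SLICE CERTIFICATE», part 3c′).

* `cellSum_sound`, `concCell_sound` — the two-point tangent inequality of `valueV(t; ·, Y)` on a cell;
  **`concPiece_sound`** — on the whole `X`-interval by the chain lemma `FarSlice.tangent_chain`;
* `yRange_sound` — `Y = 1/z` on a z-piece not straddling `0`; **`xRange_sound`** — the far point's abscissa `xNum/xDen` lies in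
  `[Xlo, Xhi]/Q` on a z-piece (g38's `xhatAF_mem` on the piece's affine coordinate, rounded outward);
* `le_of_boxOKc`, `aforms_bY` — bookkeeping.
-/

open Finset Set
open Literature.Analysis.ValidatedNumerics.NumericsMP

namespace Summit.KontsevichZagierPeriods.Zeta5Search.Barrier.ConeGamma

namespace FarSlice

open Literature.Analysis.ValidatedNumerics (AForm)
open Literature.Analysis.ValidatedNumerics.AForm (Valid mem lo_le le_hi)
open LemmaFBox (SC SC_pos coef featVal minNum maxNum box centre minNum_le le_maxNum)
open Envelope (EForm formVal vforms valF gxF valueV mul_mem_minmax)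
open CritBox (tAF coordAF boxOKc noise valid_noise tAF_mem coordAF_mem coordR linR)
open CritFar (xNum xDen xhatAF xhatAF_mem)

/-! ### The cell, the piece (chain), the `Y`-range and the `X`-range -/

/-- **The summed curvature weights bound the tangent remainder of a form list** on a cell. -/
theorem cellSum_sound {D T M : ℕ} (hD : 0 < D) (hT : 0 < T) (hM : 0 < M) {lo hi : List ℕ} {xa xb : ℤ} {Ylo Yhi : OQ}
    {t : Fin 8 → ℝ} (ht : t ∈ box D lo hi) {Y : ℝ} (hYl : ∀ q : ℚ, Ylo = some q → (q : ℝ) ≤ Y) (hYu : ∀ q : ℚ, Yhi = some q → Y ≤ (q : ℝ)) {a b : ℝ}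
    (ha : (xa : ℝ) ≤ a * (2 * D * T * M) ∧ a * (2 * D * T * M) ≤ (xb : ℝ))
    (hb : (xa : ℝ) ≤ b * (2 * D * T * M) ∧ b * (2 * D * T * M) ≤ (xb : ℝ)) :
    ∀ (F : List EForm) {σ : ℚ}, cellSum D T M lo hi xa xb Ylo Yhi F = some σ →
      valF F t b Y - valF F t a Y - (b - a) * gxF F t a Y ≤ (σ : ℝ) * (b - a) ^ 2
  | [], σ, h => by
    simp only [cellSum, Option.some.injEq] at h
    subst h
    simp [Envelope.valF_nil, Envelope.gxF_nil]
  | f :: F, σ, h => by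
    simp only [cellSum] at h
    split at h
    swap
    · simp at h
    rename_i s r hF hr
    simp only [Option.some.injEq] at h
    subst h
    have IH := cellSum_sound hD hT hM ht hYl hYu ha hb F hF
    have hf := cellRho_sound hD hT hM hr ht hYl hYu ha hb
    rw [valF_tangent] at IH ⊢
    rw [List.map_cons, List.sum_cons]
    push_cast
    have e : ((r : ℝ) * f.bx * f.bx) * (b - a) ^ 2 = (r : ℝ) * ((f.bx : ℝ) * (b - a)) ^ 2 := by ring
    rw [add_mul, e]
    linarith

/-- **The two-point tangent inequality of the slice on a cell**: with `concCell … = true`, for every `t` of the box, `Y` within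
the bounds and `a`, `b` in the `X`-sub-piece, `V(t; b, Y) ≤ V(t; a, Y) + (b − a)·∂_X-log-form(t; a, Y)`. -/
theorem concCell_sound {D T M : ℕ} (hD : 0 < D) (hT : 0 < T) (hM : 0 < M) {lo hi : List ℕ} {xa xb : ℤ} {Ylo Yhi : OQ}
    (h : concCell D T M lo hi xa xb Ylo Yhi = true) {t : Fin 8 → ℝ} (ht : t ∈ box D lo hi) {Y : ℝ} (hYl : ∀ q : ℚ, Ylo = some q → (q : ℝ) ≤ Y)
    (hYu : ∀ q : ℚ, Yhi = some q → Y ≤ (q : ℝ)) {a b : ℝ} (ha : (xa : ℝ) ≤ a * (2 * D * T * M) ∧ a * (2 * D * T * M) ≤ (xb : ℝ))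
    (hb : (xa : ℝ) ≤ b * (2 * D * T * M) ∧ b * (2 * D * T * M) ≤ (xb : ℝ)) :
    valueV t b Y ≤ valueV t a Y + (b - a) * gxF vforms t a Y := by
  unfold concCell at h
  split at h
  swap
  · simp at h
  rename_i σ hσ
  rw [decide_eq_true_eq] at h
  have := cellSum_sound hD hT hM ht hYl hYu ha hb vforms hσ
  unfold valueV
  have hσ' : (σ : ℝ) * (b - a) ^ 2 ≤ 0 := mul_nonpos_of_nonpos_of_nonneg (by exact_mod_cast h) (sq_nonneg _)
  linarith

/-- **Concavity of the slice on a whole `X`-interval** `[Ilo, Ihi]/Q`: all `M` sub-cells pass (`concPiece … = true`), so by the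
chain lemma the two-point tangent inequality holds for all `a`, `b` of the interval (every `t` of the box, `Y` within the
bounds). -/
theorem concPiece_sound {D T M : ℕ} (hD : 0 < D) (hT : 0 < T) (hM : 0 < M) {lo hi : List ℕ} {Ilo Ihi : ℤ} (hI : Ilo ≤ Ihi)
    {Ylo Yhi : OQ} (h : concPiece D T M lo hi Ilo Ihi Ylo Yhi = true) {t : Fin 8 → ℝ} (ht : t ∈ box D lo hi) {Y : ℝ}
    (hYl : ∀ q : ℚ, Ylo = some q → (q : ℝ) ≤ Y) (hYu : ∀ q : ℚ, Yhi = some q → Y ≤ (q : ℝ)) {a b : ℝ}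
    (ha : (Ilo : ℝ) ≤ a * (2 * D * T) ∧ a * (2 * D * T) ≤ (Ihi : ℝ))
    (hb : (Ilo : ℝ) ≤ b * (2 * D * T) ∧ b * (2 * D * T) ≤ (Ihi : ℝ)) :
    valueV t b Y ≤ valueV t a Y + (b - a) * gxF vforms t a Y := by
  have hQ : (0 : ℝ) < 2 * D * T := by positivity
  have hMr : (0 : ℝ) < M := by exact_mod_cast hM
  have hQM : (0 : ℝ) < 2 * D * T * M := by positivity
  -- breakpoints
  set P : ℕ → ℝ := fun k => ((Ilo : ℝ) * M + (k : ℝ) * ((Ihi : ℝ) - Ilo)) / (2 * D * T * M) with hP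
  have hmono : ∀ j < M, P j ≤ P (j + 1) := by
    intro j _
    simp only [hP]
    apply div_le_div_of_nonneg_right _ hQM.le
    have hI' : (Ilo : ℝ) ≤ Ihi := by exact_mod_cast hI
    have hk : (0 : ℝ) ≤ (Ihi : ℝ) - Ilo := by linarith
    push_cast; nlinarith
  have hloc : ∀ j < M, ∀ u ∈ Icc (P j) (P (j + 1)), ∀ v ∈ Icc (P j) (P (j + 1)),
      (fun X => valueV t X Y) v ≤ (fun X => valueV t X Y) u + (v - u) * (fun X => gxF vforms t X Y) u := by
    intro j hj u hu v hv
    unfold concPiece at h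
    have hcell := List.all_eq_true.mp h j (List.mem_range.mpr hj)
    have bounds : ∀ {w : ℝ}, w ∈ Icc (P j) (P (j + 1)) →
        ((Ilo * (M : ℤ) + (j : ℤ) * (Ihi - Ilo) : ℤ) : ℝ) ≤ w * (2 * D * T * M) ∧
          w * (2 * D * T * M) ≤ ((Ilo * (M : ℤ) + ((j : ℤ) + 1) * (Ihi - Ilo) : ℤ) : ℝ) := by
      intro w hw
      obtain ⟨h1, h2⟩ := hw
      simp only [hP] at h1 h2
      rw [div_le_iff₀ hQM] at h1
      rw [le_div_iff₀ hQM] at h2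
      push_cast at h1 h2 ⊢
      exact ⟨h1, h2⟩
    exact concCell_sound hD hT hM hcell ht hYl hYu (bounds hu) (bounds hv)
  have key := tangent_chain (f := fun X => valueV t X Y) (g := fun X => gxF vforms t X Y) M hmono hloc
  -- `[P 0, P M] = [Ilo, Ihi]/Q`
  have hP0 : P 0 = (Ilo : ℝ) / (2 * D * T) := by
    simp only [hP]; push_cast; field_simp; ring
  have hPM : P M = (Ihi : ℝ) / (2 * D * T) := by
    simp only [hP]; field_simp; ring
  have memI : ∀ {w : ℝ}, (Ilo : ℝ) ≤ w * (2 * D * T) ∧ w * (2 * D * T) ≤ (Ihi : ℝ) → w ∈ Icc (P 0) (P M) := by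
    intro w hw
    rw [hP0, hPM]
    exact ⟨by rw [div_le_iff₀ hQ]; exact hw.1, by rw [le_div_iff₀ hQ]; exact hw.2⟩
  exact key a (memI ha) b (memI hb)

/-- **The `Y = 1/z` range of a z-piece**: for `z ≠ 0` with `za ≤ z·zden ≤ zb`, the piece not straddling `0`,
`Y = z⁻¹` satisfies the optional bounds of `yRange`. -/
theorem yRange_sound {zden : ℕ} (hzden : 0 < zden) {za zb : ℤ} (hns : ¬ (za < 0 ∧ 0 < zb)) {z : ℝ}
    (hz : z ∈ zSeg zden za zb) (hz0 : z ≠ 0) :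
    (∀ q : ℚ, (yRange zden za zb).1 = some q → (q : ℝ) ≤ z⁻¹) ∧ (∀ q : ℚ, (yRange zden za zb).2 = some q → z⁻¹ ≤ (q : ℝ)) := by
  have hzd : (0 : ℝ) < zden := by exact_mod_cast hzden
  obtain ⟨h1, h2⟩ := hz
  set w := z * zden with hw
  have hw0 : w ≠ 0 := mul_ne_zero hz0 hzd.ne'
  have hinv : z⁻¹ = (zden : ℝ) / w := by rw [hw]; field_simp
  rw [hinv]
  constructor
  · intro q hq
    simp only [yRange] at hq
    by_cases hb : zb = 0
    · simp [hb] at hq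
    rw [if_neg hb] at hq
    simp only [Option.some.injEq] at hq
    subst hq
    -- `w` and `zb` have the same sign
    have sign_b : 0 < w * zb := by
      rcases lt_or_gt_of_ne hw0 with hn | hp
      · have hza : (za : ℝ) < 0 := lt_of_le_of_lt h1 hn
        have hzb : ¬ (0 : ℤ) < zb := fun h => hns ⟨by exact_mod_cast hza, h⟩
        have hzb' : (zb : ℝ) < 0 := by
          have : zb < 0 := lt_of_le_of_ne (not_lt.mp hzb) hb
          exact_mod_cast this
        exact mul_pos_of_neg_of_neg hn hzb'
      · exact mul_pos hp (lt_of_lt_of_le hp h2)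
    have e : (zden : ℝ) / w - (zden : ℝ) / zb = (zden : ℝ) * ((zb : ℝ) - w) / (w * zb) := by
      have : (zb : ℝ) ≠ 0 := by exact_mod_cast hb
      field_simp
    have : 0 ≤ (zden : ℝ) / w - (zden : ℝ) / zb := by
      rw [e]; exact div_nonneg (mul_nonneg hzd.le (by linarith)) sign_b.le
    have hc : ((((zden : ℚ) / zb : ℚ)) : ℝ) = (zden : ℝ) / zb := by push_cast; ring
    rw [hc]; linarith
  · intro q hq
    simp only [yRange] at hq
    by_cases ha : za = 0
    · simp [ha] at hq
    rw [if_neg ha] at hq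
    simp only [Option.some.injEq] at hq
    subst hq
    have sign_a : 0 < w * za := by
      rcases lt_or_gt_of_ne hw0 with hn | hp
      · exact mul_pos_of_neg_of_neg hn (lt_of_le_of_lt h1 hn)
      · have hzb : (0 : ℝ) < zb := lt_of_lt_of_le hp h2
        have hza : ¬ za < 0 := fun h => hns ⟨h, by exact_mod_cast hzb⟩
        have hza' : (0 : ℝ) < za := by
          have : 0 < za := lt_of_le_of_ne (not_lt.mp hza) (Ne.symm ha)
          exact_mod_cast this
        exact mul_pos hp hza'
    have e : (zden : ℝ) / za - (zden : ℝ) / w = (zden : ℝ) * (w - (za : ℝ)) / (w * za) := by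
      have : (za : ℝ) ≠ 0 := by exact_mod_cast ha
      field_simp
    have : 0 ≤ (zden : ℝ) / za - (zden : ℝ) / w := by
      rw [e]; exact div_nonneg (mul_nonneg hzd.le (by linarith)) sign_a.le
    have hc : ((((zden : ℚ) / za : ℚ)) : ℝ) = (zden : ℝ) / za := by push_cast; ring
    rw [hc]; linarith

/-- **The far point's abscissa on a z-piece.** With `xRange … za zb = some (Xlo, Xhi)`, for every `t` of the box (`t₀ = 1`)
and every `z` of the piece: `xDen t z ≠ 0` and `Xlo ≤ Q·(xNum t z / xDen t z) ≤ Xhi` (cert-2 g38's `xhatAF_mem` at the piece's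
affine coordinate, rounded outward to the scale `Q`). -/
theorem xRange_sound {D T : ℕ} {lo hi : List ℕ} (hok : boxOKc D lo hi = true) (hT : 0 < T) {zden : ℕ} (hzden : 0 < zden)
    {za zb : ℤ} (hlt : za < zb) {Xlo Xhi : ℤ} (h : xRange D T lo hi zden za zb = some (Xlo, Xhi)) {t : Fin 8 → ℝ}
    (ht : t ∈ box D lo hi) (ht0 : t 0 = 1) {z : ℝ} (hz : z ∈ zSeg zden za zb) :
    xDen t z ≠ 0 ∧ (Xlo : ℝ) ≤ xNum t z / xDen t z * (2 * D * T) ∧ xNum t z / xDen t z * (2 * D * T) ≤ (Xhi : ℝ) := by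
  unfold xRange at h
  obtain ⟨XA, hXA, hpair⟩ := Option.map_eq_some_iff.mp h
  simp only [Prod.mk.injEq] at hpair
  obtain ⟨rfl, rfl⟩ := hpair
  have hzd : (0 : ℝ) < zden := by exact_mod_cast hzden
  -- the piece parameter `η ∈ [−1, 1]` with `z = ((za + zb) + (zb − za) η)/(2 zden)`
  have hlt' : (za : ℝ) < zb := by exact_mod_cast hlt
  have hd : (0 : ℝ) < (zb : ℝ) - za := by linarith
  set η : ℝ := (2 * (z * zden) - (za + zb)) / ((zb : ℝ) - za) with hη
  have hηabs : |η| ≤ 1 := by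
    rw [hη, abs_div, abs_of_pos hd, div_le_one hd, abs_le]
    obtain ⟨h1, h2⟩ := hz
    constructor <;> linarith
  have hv := valid_noise hok ht (show |(0 : ℝ)| ≤ 1 by simp) hηabs
  have htA := tAF_mem hok ht ht0 (show |(0 : ℝ)| ≤ 1 by simp) hηabs
  set ε := noise D lo hi t 0 η with hε
  have hQ' : 0 < 2 * zden := by omega
  have hzmem : mem SC ε z (coordAF (za + zb) [0, 0, 0, 0, 0, 0, 0] (zb - za).toNat 9 (2 * zden)) := by
    have := coordAF_mem hv (za + zb) [0, 0, 0, 0, 0, 0, 0] (zb - za).toNat hQ' 9 (Or.inr rfl)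
    have e9 : ε 9 = η := by simp [hε, noise]
    convert this using 2
    rw [coordR, e9]
    have hn : (((zb - za).toNat : ℕ) : ℝ) = (zb : ℝ) - za := by
      have : ((zb - za).toNat : ℤ) = zb - za := Int.toNat_of_nonneg (by omega)
      exact_mod_cast this
    rw [hn, hη]
    simp [linR]
    field_simp
    ring
  obtain ⟨hD0, hX⟩ := xhatAF_mem hv htA hzmem hXA
  have hlo := lo_le hv hX
  have hhi := le_hi hv hX
  have hS : (0 : ℝ) < SC := by exact_mod_cast SC_pos
  have hQn : ((2 * D * T : ℕ) : ℝ) = 2 * D * T := by push_cast; ring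
  refine ⟨hD0, ?_, ?_⟩
  · -- `Xlo = ⌊XA.lo·Q/SC⌋ ≤ X·Q`
    have key := Int.ediv_mul_le (AForm.lo XA * (2 * D * T : ℕ)) (by exact_mod_cast SC_pos.ne' : (SC : ℤ) ≠ 0)
    have key' : (((AForm.lo XA * (2 * D * T : ℕ)) / (SC : ℤ) : ℤ) : ℝ) * SC ≤ (AForm.lo XA : ℝ) * (2 * D * T) := by
      have := (Int.cast_le (R := ℝ)).mpr key
      push_cast at this ⊢
      linarith
    have h2 := mul_le_mul_of_nonneg_right hlo (by positivity : (0 : ℝ) ≤ 2 * D * T)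
    -- `⌊·⌋·SC ≤ lo·Q ≤ X·SC·Q`
    nlinarith [key', h2, hS]
  · -- `X·Q ≤ ⌈XA.hi·Q/SC⌉ = −⌊−XA.hi·Q/SC⌋`
    have key := Int.ediv_mul_le (-(AForm.hi XA) * (2 * D * T : ℕ)) (by exact_mod_cast SC_pos.ne' : (SC : ℤ) ≠ 0)
    have key' : (((-(AForm.hi XA) * (2 * D * T : ℕ)) / (SC : ℤ) : ℤ) : ℝ) * SC ≤ -(AForm.hi XA : ℝ) * (2 * D * T) := by
      have := (Int.cast_le (R := ℝ)).mpr key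
      push_cast at this ⊢
      linarith
    have h2 := mul_le_mul_of_nonneg_right hhi (by positivity : (0 : ℝ) ≤ 2 * D * T)
    rw [Int.cast_neg]
    nlinarith [key', h2, hS]

/-- `boxOKc` gives `D > 0` and `lo_i ≤ hi_i` for all eight coordinates. -/
theorem le_of_boxOKc {D : ℕ} {lo hi : List ℕ} (hok : boxOKc D lo hi = true) :
    0 < D ∧ ∀ i : Fin 8, lo.getD i 0 ≤ hi.getD i 0 := by
  simp only [boxOKc, decide_eq_true_eq] at hok
  obtain ⟨hD, _, _, hlo0, hhi0, hall⟩ := hok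
  refine ⟨hD, fun i => ?_⟩
  refine Fin.cases ?_ (fun j => ?_) i
  · show lo.getD 0 0 ≤ hi.getD 0 0
    rw [hlo0, hhi0]
  · have := hall j.val (List.mem_range.2 j.isLt)
    show lo.getD (j.val + 1) 0 ≤ hi.getD (j.val + 1) 0
    exact this.2.1.le

/-- The thirteen `Y`-free forms have `β′ = 0`. -/
theorem aforms_bY : ∀ f ∈ aforms, f.bY = 0 := by
  decide

end FarSlice

end Summit.KontsevichZagierPeriods.Zeta5Search.Barrier.ConeGamma
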